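import Literature.NumberTheory.GaloisRepresentations.GalLayerSystemIhomLayers
import Literature.NumberTheory.GaloisRepresentations.IdeleClassBarSubgroupHThree
import Literature.Algebra.Homology.DiscreteRepExtInternalHom
import Literature.Algebra.Homology.DiscreteRepCoindPresentation
import Literature.Algebra.Homology.DiscreteRepContinuous
import HarnessLib

/-!
# `Extʳ_{C_Γ}(N, C̄) = 0` for `r ≥ 3` and every discrete `Γ_F`-lattice `N`: Milne ADT I Lemma 1.9 for the idèle
# class formation — the hypothesis `hN` behind `ext_eq_zero_of_four_le` of Tate's duality theorem
# (Milne ADT I Lemma 1.9; Harari Lemma 16.20; Tate, C–F VII §11.3)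

Topic `NumberTheory/GaloisRepresentations`; namespace `Literature.NumberTheory.GaloisRepresentations.IdeleClassBar`.
Definitions with bodies (the discrete topological representation `discTopRep M` presenting an object `M ∈ C_Γ` as the base
of door-c4's standard complex) and theorems; no named fact, no instance, no `sorry`.  Sequel to
`GalLayerSystemIhomLayers.lean` (door-c6 g15: the layers `Hⁿ(Γ⧸U_E, (Hom(N, lim S))^{U_E}) ≅ Hⁿ(Gal(E/F), Hom(N_E, D.obj E))`
and their transitions `ihomInf`), `Algebra/Homology/TateNakayamaInflationVanishingHom.lean` (door-c6 g15:
`IsClassModule.map_ihom_eq_zero_of_card_dvd`), `GalLayerEmbedding.lean` (door-c6 g15: cyclotomic layers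
`GalLayer.exists_ge_finrank_dvd`), door-c4's `DiscreteRepExtInternalHom` (`extIhomAddEquivOfProjective`: Harari 16.16 (b),
`Extʳ(N, X) ≃ Extʳ(ℤ, Hom(N, X))` for `N` a lattice), `DiscreteRepLayerColimitGroupCohomology` ((d):
`ext_eq_zero_of_forall_exists_stepG_eq_zero`), `DiscreteRepCoindPresentation` (`exists_openNormalSubgroup_forall_apply_eq`),
door-c5 g16's `GalLayerSystemIdele` (`classData_toD : (classData F).toSystem.toD = classBarD F`) and door-c4 g11's
compatible fundamental classes (`IdeleClassGaloisRepInflation`).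

THE POINT.  Door-c4's `tateDualityHypotheses_of_torsionFree` (p590419, USE-door-c4-g15 §1) derives the field
`ext_eq_zero_of_four_le` of `TateDualityHypotheses (classBarD F) inv` from
`hN : ∀ N, Module.Finite ℤ N → IsAddTorsionFree N → ∀ r ≥ 3, Extʳ_{C_Γ}(N, C̄) = 0` (Milne ADT I Lemma 1.9 for
`(Γ_F, C̄)`).  THIS FILE PROVES `hN`: **`ext_classBarD_eq_zero_of_torsionFree`**.  Proof (Milne's, p. 22): a discrete
lattice `N` is projective over `ℤ`, so `Extʳ(N, C̄) ≃ Extʳ(ℤ, Hom(N, C̄))` (Harari 16.16 (b)); `Hom(N, C̄) ∈ C_Γ` has layers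
`Hʳ(Gal(E/F), Hom(N_E, C_E))` at the (cofinal) layers `E` whose group acts trivially on `N`, and every class of such a
layer dies in the cyclotomic layer `M = E(ζ_ℓ)`, `[E:F] ∣ [M:E]` (`ihomInf_eq_zero_of_finrank_dvd`: Tate–Nakayama for the
class module `(Gal(E/F), C_E)` with `Hom`-coefficients, `Inf u_E = [M:E]·u_M`); the vanishing transfer (d) concludes.

## What is formalised (`F : Type` a number field, `Γ = absoluteGaloisGroup F`)

* §1 `discTopRep M` (an object of `C_Γ` as a `TopRep` with the discrete topology; `discreteTopology_discTopRep`,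
  **`stdBase_discTopRep : stdBase (discTopRep M) _ = M`**), so that door-c4's `extIhomAddEquivOfProjective` /
  `extTrivAddEquivContinuousCohomology` apply to EVERY object of `C_Γ`.
* §2 `exists_trivialOn` (a layer acting trivially on a discrete module of finite type),
  **`ihomInf_eq_zero_of_finrank_dvd`** (the transitions of the `Hom(N, C_E)`-system vanish in degrees `≥ 3` for
  `[E:F] ∣ [M:E]`), **`ext_triv_ihom_classBarD_eq_zero_of_three_le`** (`Extʳ_{C_Γ}(ℤ, Hom(N, C̄)) = 0`, `r ≥ 3`).
* §3 **`ext_latticeD_classBarD_eq_zero_of_three_le`** (`Extʳ_{C_Γ}(N, C̄) = 0` for the lattice given by `ρN`) and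
  **`ext_classBarD_eq_zero_of_torsionFree`** — `hN` verbatim: for every `N : DiscreteRepCat ℤ Γ_F` with `N.obj.V`
  finitely generated (for the module structure it carries) and torsion-free, every `r ≥ 3` and every
  `x : Ext N (classBarD F) r`, `x = 0`.

Written for Route A of the Poitou–Tate programme of crux `AnticycControlAdditiveK` (cell bsd-schneider, item 19295), seat
door-c6 gen 15.  HONEST FRAMING: with `IdeleClassBarSubgroupHOne/HThree` this supplies three of the class-formation
hypotheses of the abstract duality theorem for `(Γ_F, C̄)`; no case of Poitou–Tate duality and no case of BSD is proved.

## References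
* J. S. Milne, *Arithmetic Duality Theorems* (2nd ed. 2006), I §1, Lemma 1.9 and Theorem 1.8 (proof). [MilneADT2006]
* D. Harari, *Galois Cohomology and Class Field Theory* (2020), §16.2 Prop. 16.16 (b); §16.3 Lemma 16.20. [Harari2020]
* J. W. S. Cassels, A. Fröhlich (eds.), *Algebraic Number Theory* (1967), Ch. VII (J. Tate) §11.3. [CasselsFrohlichANT1967]
* J.-P. Serre, *Galois Cohomology*, Springer (1997), I §2.2 Proposition 8. [SerreGaloisCohomology1997]
-/

noncomputable section

open CategoryTheory CategoryTheory.Abelian groupCohomology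
open Field (absoluteGaloisGroup)
open Literature.Algebra.Homology
open Literature.NumberTheory.Automorphic Literature.NumberTheory.Automorphic.IdeleClassGroup
open scoped Classical

namespace Literature.NumberTheory.GaloisRepresentations

open IdeleClassBar

/-! ## §1 Every object of `C_Γ` is the base of a standard complex -/

section TopRepPresentation

variable {Γ : Type} [Group Γ] [TopologicalSpace Γ] [IsTopologicalGroup Γ] [CompactSpace Γ] (M : DiscreteRepCat ℤ Γ)

/-- **An object of `C_Γ` as a topological representation with the DISCRETE topology** (its action is continuous
because the stabilisers are open: the cell's `DiscreteRep.toContinuousRep`). [cite: SerreGaloisCohomology1997, I §2.1] -/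
def discTopRep : TopRep ℤ Γ :=
  letI : TopologicalSpace M.obj.V := ⊥
  haveI : DiscreteTopology M.obj.V := ⟨rfl⟩
  letI := M.obj.hV2
  -- continuity of the scalar action for the `Module ℤ` structure the object carries (everything is discrete)
  haveI : @ContinuousSMul ℤ M.obj.V M.obj.hV2.toDistribMulAction.toMulAction.toSMul _ _ :=
    @ContinuousSMul.mk ℤ M.obj.V M.obj.hV2.toDistribMulAction.toMulAction.toSMul _ _
      continuous_of_discreteTopology
  (DiscreteRep.toContinuousRep M.obj.ρ M.property).toTopRep

omit [CompactSpace Γ] in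
/-- The topology of `discTopRep M` is discrete. [cite: SerreGaloisCohomology1997, I §2.1] -/
theorem discreteTopology_discTopRep : DiscreteTopology (discTopRep M).V :=
  letI : TopologicalSpace M.obj.V := ⊥
  ⟨rfl⟩

omit [CompactSpace Γ] in
/-- `discTopRep M` has open stabilisers (it is `M`). [cite: SerreGaloisCohomology1997, I §2.1] -/
theorem isDiscrete_discTopRep : DiscreteRep.IsDiscrete ((DiscreteRep.forgetTop ℤ Γ).obj (discTopRep M)) :=
  M.property

/-- **`stdBase (discTopRep M) = M`**: door-c4's standard-complex base of the discrete presentation IS the object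
(definitionally). [cite: Harari2020, §4.3] -/
theorem stdBase_discTopRep :
    @DiscreteRep.stdBase ℤ Γ _ _ _ _ _ _ (discTopRep M) (discreteTopology_discTopRep M) (isDiscrete_discTopRep M) =
      M :=
  rfl

end TopRepPresentation

/-! ## §2 The `Hom(N, C_E)`-system: its transitions vanish in degrees `≥ 3`, and `Extʳ_{C_Γ}(ℤ, Hom(N, C̄)) = 0` -/

namespace IdeleClassBar

variable {F : Type} [Field F] [NumberField F]
variable {V : Type} [AddCommGroup V] (ρN : Representation ℤ (absoluteGaloisGroup F) V)
  (hρN : DiscreteRep.IsDiscrete (Rep.of ρN)) [Module.Finite ℤ V]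

include hρN in
/-- A discrete module of finite type is fixed pointwise by the group of some layer (door-c4's
`exists_openNormalSubgroup_forall_apply_eq` + the dictionary `GalLayer F ≃o (OpenNormalSubgroup Γ_F)ᵒᵈ`).
[cite: MilneADT2006, I Theorem 1.8 (proof)] -/
theorem exists_trivialOn : ∃ E₀ : GalLayer F, TrivialOn ρN E₀ := by
  obtain ⟨U, hU⟩ := DiscreteRep.exists_openNormalSubgroup_forall_apply_eq
    (GalLayerData.latticeD ρN hρN)
  refine ⟨GalLayer.ofOpenNormalSubgroup U, fun σ hσ x => hU σ ?_ x⟩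
  rwa [GalLayer.openNormalSubgroup_ofOpenNormalSubgroup] at hσ

variable [Module.Free ℤ V]

set_option maxHeartbeats 1600000 in
-- `exact` bridges `(classData F).obj E = galoisRep F E` and the `ℤ`-instance paths by definitional unfolding
/-- **The transitions `Hⁿ⁺³(Gal(E/F), Hom(N_E, C_E)) → Hⁿ⁺³(Gal(M/F), Hom(N_M, C_M))` vanish for `[E:F] ∣ [M:E]`**
(Tate–Nakayama with `Hom`-coefficients for the class module `(Gal(E/F), C_E)` and the compatible fundamental classes
`Inf u_E = [M:E]·u_M` of door-c4 g11). [cite: MilneADT2006, I Lemma 1.9][cite: Harari2020, §16.3 Lemma 16.20] -/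
theorem ihomInf_eq_zero_of_finrank_dvd {E M : GalLayer F} (h : E ≤ M) (hE : TrivialOn ρN E) (hM : TrivialOn ρN M)
    (hdvd : Module.finrank F E.1 ∣ (letI := GalLayer.algebraOfLE h; Module.finrank E.1 M.1)) (n : ℕ)
    (y : groupCohomology ((Rep.ihom (coeff ρN hE)).obj ((classData F).obj E)) (n + 3)) :
    (classData F).ihomInf ρN h hE hM (n + 3) y = 0 := by
  haveI := E.numberField
  haveI := M.numberField
  haveI := E.isGalois
  haveI := M.isGalois
  letI := GalLayer.algebraOfLE h
  haveI := GalLayer.isScalarTower_of_le h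
  letI : Fintype (E.1 ≃ₐ[F] E.1) := Fintype.ofFinite _
  obtain ⟨φE, φM, hEcm, -, hc⟩ :=
    exists_isClassModule_pair_map_eq_finrank_smul (F := F) (E := E.1) (M := M.1) ((classData F).baseRepHom h)
      (classData_baseRepHom_hom_apply h)
  rw [natCast_zsmul] at hc
  have hcard : Nat.card (E.1 ≃ₐ[F] E.1) ∣ Module.finrank E.1 M.1 := by
    rw [IsGalois.card_aut_eq_finrank]
    exact hdvd
  exact hEcm.map_ihom_eq_zero_of_card_dvd (GalLayer.resHom h) ((classData F).baseRepHom h) (coeff ρN hE) _ hc hcard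
    (coeff ρN hM) (LinearEquiv.refl ℤ V) (GalLayerData.coeff_refl_comm ρN h hE hM) n y

/-- **`Extʳ_{C_Γ}(ℤ, Hom(N, C̄)) = 0` for `r ≥ 3`** — (d) for the module `Hom(N, C̄)`: a class of a layer `U` is pushed to a
layer `U_E` with `U_E` acting trivially on `N` (cofinality), read as a class of `Hʳ(Gal(E/F), Hom(N_E, C_E))`
(`ihomLayerCohomologyIso`), and killed in the cyclotomic layer (`ihomInf_eq_zero_of_finrank_dvd`,
`GalLayer.exists_ge_finrank_dvd`). [cite: MilneADT2006, I Lemma 1.9][cite: Harari2020, §16.3 Lemma 16.20] -/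
theorem ext_triv_ihom_classBarD_eq_zero_of_three_le (r : ℕ) (hr : 3 ≤ r)
    (x : Ext (DiscreteRep.triv (Γ := absoluteGaloisGroup F) ℤ)
      (DiscreteRep.ihomObj (GalLayerData.latticeD ρN hρN) (classBarD F)) r) : x = 0 := by
  obtain ⟨n, rfl⟩ : ∃ n, r = n + 3 := ⟨r - 3, by omega⟩
  obtain ⟨E₀, hE₀⟩ := exists_trivialOn ρN hρN
  -- `(classData F).toSystem.toD = classBarD F` definitionally (`classData_toD`)
  refine DiscreteRep.LayerColimit.ext_eq_zero_of_forall_exists_stepG_eq_zero (n + 3)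
    (DiscreteRep.ihomObj (GalLayerData.latticeD ρN hρN) (classData F).toSystem.toD) (fun V c => ?_) x
  -- push the class to a layer `E ≥ E₀, F̄^V`
  obtain ⟨E, hVE, h₀E⟩ := GalLayer.exists_ge_ge (GalLayer.ofOpenNormalSubgroup V) E₀
  have hE : TrivialOn ρN E := hE₀.mono h₀E
  have hVU : (E.openNormalSubgroup : Subgroup (absoluteGaloisGroup F)) ≤ V := by
    have h' := GalLayer.coe_openNormalSubgroup_le hVE
    rwa [GalLayer.openNormalSubgroup_ofOpenNormalSubgroup] at h'
  -- kill it in the cyclotomic layer `M ⊇ E`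
  obtain ⟨M, hEM, hdvd⟩ := GalLayer.exists_ge_finrank_dvd E
  have hM : TrivialOn ρN M := hE.mono hEM
  refine ⟨M.openNormalSubgroup, (GalLayer.coe_openNormalSubgroup_le hEM).trans hVU, ?_⟩
  rw [← DiscreteRep.LayerColimit.stepG_stepG V E.openNormalSubgroup hVU _ (n + 3) M.openNormalSubgroup
    (GalLayer.coe_openNormalSubgroup_le hEM) c]
  set c' := DiscreteRep.LayerColimit.stepG V E.openNormalSubgroup hVU
    (DiscreteRep.ihomObj (GalLayerData.latticeD ρN hρN) (classData F).toSystem.toD) (n + 3) c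
  have h1 : ((classData F).ihomLayerCohomologyIso ρN hρN hM (n + 3)).hom
      (DiscreteRep.LayerColimit.stepG E.openNormalSubgroup M.openNormalSubgroup
        (GalLayer.coe_openNormalSubgroup_le hEM) _ (n + 3) c') = 0 := by
    rw [(classData F).ihomLayerCohomologyIso_stepG ρN hρN hEM hE hM (n + 3) c',
      ihomInf_eq_zero_of_finrank_dvd ρN hEM hE hM hdvd n]
  rw [← CategoryTheory.Iso.hom_inv_id_apply ((classData F).ihomLayerCohomologyIso ρN hρN hM (n + 3))
    (DiscreteRep.LayerColimit.stepG E.openNormalSubgroup M.openNormalSubgroup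
      (GalLayer.coe_openNormalSubgroup_le hEM) _ (n + 3) c'), h1, map_zero]

/-! ## §3 `Extʳ_{C_Γ}(N, C̄) = 0` for `r ≥ 3` and every discrete lattice `N` -/

/-- **`Extʳ_{C_Γ}(N, C̄) = 0` for `r ≥ 3`** for the discrete lattice `N = (V, ρN)` (`V` finitely generated free):
`Extʳ(N, C̄) ≃ Extʳ(ℤ, Hom(N, C̄))` (Harari 16.16 (b), door-c4's `extIhomAddEquivOfProjective` on the discrete presentation
`discTopRep`) `= 0`. [cite: MilneADT2006, I Lemma 1.9][cite: Harari2020, §16.2 Proposition 16.16 (b)] -/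
theorem ext_latticeD_classBarD_eq_zero_of_three_le (r : ℕ) (hr : 3 ≤ r)
    (x : Ext (GalLayerData.latticeD ρN hρN) (classBarD F) r) : x = 0 := by
  haveI : DiscreteTopology (discTopRep (classBarD F)).V := discreteTopology_discTopRep _
  have h := ext_triv_ihom_classBarD_eq_zero_of_three_le ρN hρN r hr
    (DiscreteRep.extIhomAddEquivOfProjective (GalLayerData.latticeD ρN hρN) (discTopRep (classBarD F))
      (isDiscrete_discTopRep (classBarD F)) r x)
  exact (map_eq_zero_iff _ (DiscreteRep.extIhomAddEquivOfProjective (GalLayerData.latticeD ρN hρN)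
    (discTopRep (classBarD F)) (isDiscrete_discTopRep (classBarD F)) r).injective).1 h

/-- The lattice case for an arbitrary `Module ℤ` structure on `V` (all such structures coincide).
[cite: MilneADT2006, I Lemma 1.9] -/
theorem ext_mk_classBarD_eq_zero_of_three_le {W : Type} [AddCommGroup W] [inst : Module ℤ W]
    (ρ : Representation ℤ (absoluteGaloisGroup F) W) (hρ : DiscreteRep.IsDiscrete (Rep.of ρ))
    (hfin : Module.Finite ℤ W) (htf : IsAddTorsionFree W) (r : ℕ) (hr : 3 ≤ r)
    (x : Ext (DiscreteRep.mk (Rep.of ρ) hρ) (classBarD F) r) : x = 0 := by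
  obtain rfl : inst = AddCommGroup.toIntModule W := Subsingleton.elim _ _
  haveI : Module.Free ℤ W := Module.free_of_finite_type_torsion_free'
  exact ext_latticeD_classBarD_eq_zero_of_three_le ρ hρ r hr x

/-- **Milne ADT I Lemma 1.9 for the idèle class formation `(Γ_F, C̄)` — the hypothesis `hN` of door-c4's
`tateDualityHypotheses_of_torsionFree`, verbatim**: for every discrete `Γ_F`-module `N` whose underlying group is
finitely generated and torsion-free, `Extʳ_{C_{Γ_F}}(N, C̄) = 0` for all `r ≥ 3`.
[cite: MilneADT2006, I Lemma 1.9][cite: Harari2020, §16.3 Lemma 16.20] -/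
theorem ext_classBarD_eq_zero_of_torsionFree (N : DiscreteRepCat ℤ (absoluteGaloisGroup F))
    (hfin : @Module.Finite ℤ N.obj.V _ _ N.obj.hV2) (htf : IsAddTorsionFree N.obj.V) (r : ℕ) (hr : 3 ≤ r)
    (x : Ext N (classBarD F) r) : x = 0 :=
  ext_mk_classBarD_eq_zero_of_three_le (inst := N.obj.hV2) N.obj.ρ N.property hfin htf r hr x

end IdeleClassBar

end Literature.NumberTheory.GaloisRepresentations

end
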